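import Summits.MatrixMultiplication.MatrixMultiplication.Theses.SnSubsetDichotomy
import Literature.Barriers.MatrixMultiplication.YoungSubgroupBarrier
import Literature.Barriers.MatrixMultiplication.YoungSubgroupCounting

/-!
# Stub `stub_hostedPairCount` (crux stmt-MatrixMultiplication-8303, line young-host-squeeze)

Crux `Summit.MatrixMultiplication.MatrixMultiplication.Theses.SnSubsetDichotomy.GlobalBranch`, line
`young-host-squeeze`: the counted pair packing in a Young double coset.

For `A, B ⊆ S_n` with the pairwise part of the TPP (`s s'⁻¹ t t'⁻¹ = 1 ⇒ s = s', t = t'`), two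
labellings `f g : Fin n → ℕ` and coset parameters `a b a' b'`, the parts `A' = A ∩ a·Y_f·b` and
`B' = B ∩ a'·Y_g·b'` satisfy
`|A'| · |B'| · ∏_cells e_q! ≤ ∏_rows bᵢ! · ∏_cols cⱼ!`,
rows = blocks of `f`, columns = blocks of `g' = g ∘ y` (`y = a'⁻¹ a`), cells = blocks of the
pair labelling `h = (f, g')`.

Proof.  Let `K = {σ | h ∘ σ = h} = Y_f ∩ Y_{g'}` (as a `Finset`).  The map
`((s, t), k) ↦ (k · a⁻¹ s b⁻¹, k · y⁻¹ (a'⁻¹ t b'⁻¹) y)` sends `(A' × B') × K` into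
`Y_f × Y_{g'}` (`y⁻¹ Y_g y = Y_{g ∘ y}`, `hostedPairCount_conj_mem`) and is injective: from the
image `(u, v)` one recovers `u⁻¹ v = b s⁻¹ t b'⁻¹ y`, hence `s⁻¹ t`, hence `(s, t)` by the
pairwise TPP, hence `k` (`hostedPairCount_card_mul_le`).  So `|A'| |B'| |K| ≤ |Y_f| |Y_{g'}|`.
Finally `|K| = ∏_cells e_q!` exactly (Mathlib `DomMulAct.stabilizer_card'`,
`hostedPairCount_card_filter_comp_eq`) and `|Y_f| ≤ ∏_rows bᵢ!`, `|Y_{g'}| ≤ ∏_cols cⱼ!` (tree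
`Literature.Barriers.MatrixMultiplication.card_youngSubgroup_le`,
`hostedPairCount_card_filter_mem_le`).
-/

set_option linter.dupNamespace false

open scoped BigOperators Classical
open Finset

namespace Summit.MatrixMultiplication.MatrixMultiplication.Theorems.GlobalBranch

open Literature.Barriers.MatrixMultiplication

variable {n : ℕ}

/-- Conjugation by `y` carries the Young subgroup of `g` into the Young subgroup of `g ∘ y`:
if `σ` preserves the fibres of `g` then `y⁻¹ σ y` preserves the fibres of `p ↦ g (y p)`. -/
theorem hostedPairCount_conj_mem {α : Type*} {g : Fin n → α} {σ : Equiv.Perm (Fin n)}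
    (hσ : σ ∈ youngSubgroup g) (y : Equiv.Perm (Fin n)) :
    y⁻¹ * σ * y ∈ youngSubgroup (fun p => g (y p)) := by
  rw [mem_youngSubgroup] at hσ ⊢
  intro p
  simp only [Equiv.Perm.mul_apply, Equiv.Perm.coe_inv, Equiv.apply_symm_apply]
  exact hσ (y p)

/-- The order of the Young subgroup `{σ | h ∘ σ = h}` of a labelling `h`, as a filtered `Finset`,
is the product of the factorials of its block sizes (Mathlib `DomMulAct.stabilizer_card'`). -/
theorem hostedPairCount_card_filter_comp_eq {ι : Type*} [DecidableEq ι] (h : Fin n → ι) :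
    (univ.filter (fun σ : Equiv.Perm (Fin n) => h ∘ σ = h)).card =
      ∏ q ∈ univ.image h, ((univ.filter (fun p => h p = q)).card).factorial := by
  have h1 := DomMulAct.stabilizer_card' h
  simp only [Fintype.card_subtype] at h1
  exact h1

/-- The order of a Young subgroup `Y_f`, as a filtered `Finset`, is at most the product of the
factorials of its block sizes (tree `card_youngSubgroup_le`). -/
theorem hostedPairCount_card_filter_mem_le (f : Fin n → ℕ) :
    (univ.filter (fun σ : Equiv.Perm (Fin n) => σ ∈ youngSubgroup f)).card ≤
      ∏ i ∈ univ.image f, ((univ.filter (fun p => f p = i)).card).factorial :=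
  calc (univ.filter (fun σ : Equiv.Perm (Fin n) => σ ∈ youngSubgroup f)).card
      = Nat.card (youngSubgroup f) := (Nat.subtype_card _ (fun σ => by simp)).symm
    _ ≤ _ := card_youngSubgroup_le f

/-- **Counted packing through an injection.**  If `(s, t) ↦ s⁻¹ t` is injective on `A' × B'`,
every `k ∈ K` satisfies `k · a⁻¹ s b⁻¹ ∈ YF` for `s ∈ A'` and
`k · (a'⁻¹a)⁻¹ (a'⁻¹ t b'⁻¹) (a'⁻¹a) ∈ YG` for `t ∈ B'`, then `|A'| |B'| |K| ≤ |YF| |YG|`: the map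
`((s, t), k) ↦ (k · a⁻¹ s b⁻¹, k · (a'⁻¹a)⁻¹ (a'⁻¹ t b'⁻¹) (a'⁻¹a))` is injective on
`(A' × B') × K` (the quotient `u⁻¹ v` of the image `(u, v)` is `b s⁻¹ t b'⁻¹ a'⁻¹ a`). -/
theorem hostedPairCount_card_mul_le (A' B' K YF YG : Finset (Equiv.Perm (Fin n)))
    (a b a' b' : Equiv.Perm (Fin n))
    (hinj : ∀ s₁ ∈ A', ∀ s₂ ∈ A', ∀ t₁ ∈ B', ∀ t₂ ∈ B',
      s₁⁻¹ * t₁ = s₂⁻¹ * t₂ → s₁ = s₂ ∧ t₁ = t₂)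
    (hA : ∀ s ∈ A', ∀ k ∈ K, k * (a⁻¹ * s * b⁻¹) ∈ YF)
    (hB : ∀ t ∈ B', ∀ k ∈ K, k * ((a'⁻¹ * a)⁻¹ * (a'⁻¹ * t * b'⁻¹) * (a'⁻¹ * a)) ∈ YG) :
    A'.card * B'.card * K.card ≤ YF.card * YG.card := by
  rw [← Finset.card_product, ← Finset.card_product, ← Finset.card_product]
  refine Finset.card_le_card_of_injOn
    (fun p => (p.2 * (a⁻¹ * p.1.1 * b⁻¹),
      p.2 * ((a'⁻¹ * a)⁻¹ * (a'⁻¹ * p.1.2 * b'⁻¹) * (a'⁻¹ * a)))) ?_ ?_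
  · rintro ⟨⟨s, t⟩, k⟩ hp
    simp only [Finset.mem_coe, Finset.mem_product] at hp
    obtain ⟨⟨hs, ht⟩, hk⟩ := hp
    exact Finset.mem_coe.2 (Finset.mem_product.2 ⟨hA s hs k hk, hB t ht k hk⟩)
  · rintro ⟨⟨s₁, t₁⟩, k₁⟩ h₁ ⟨⟨s₂, t₂⟩, k₂⟩ h₂ heq
    simp only [Finset.mem_coe, Finset.mem_product] at h₁ h₂
    simp only [Prod.mk.injEq] at heq
    obtain ⟨e₁, e₂⟩ := heq
    have key : ∀ s t k : Equiv.Perm (Fin n),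
        (k * (a⁻¹ * s * b⁻¹))⁻¹ * (k * ((a'⁻¹ * a)⁻¹ * (a'⁻¹ * t * b'⁻¹) * (a'⁻¹ * a))) =
          b * (s⁻¹ * t) * (b'⁻¹ * (a'⁻¹ * a)) := by
      intro s t k
      group
    have e : b * (s₁⁻¹ * t₁) * (b'⁻¹ * (a'⁻¹ * a)) = b * (s₂⁻¹ * t₂) * (b'⁻¹ * (a'⁻¹ * a)) := by
      rw [← key s₁ t₁ k₁, ← key s₂ t₂ k₂, e₁, e₂]
    obtain ⟨rfl, rfl⟩ := hinj s₁ h₁.1.1 s₂ h₂.1.1 t₁ h₁.1.2 t₂ h₂.1.2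
      (mul_left_cancel (mul_right_cancel e))
    obtain rfl : k₁ = k₂ := mul_right_cancel e₁
    rfl

/-- **Hosted pair count** (stub `stub_hostedPairCount` of line `young-host-squeeze`).  For
`A, B ⊆ S_n` with the pairwise part of the TPP (`s s'⁻¹ t t'⁻¹ = 1 ⇒ s = s', t = t'`), two
labellings `f g : Fin n → ℕ` and coset parameters `a b a' b'`, the parts `A ∩ a·Y_f·b`,
`B ∩ a'·Y_g·b'` satisfy `|A ∩ aY_fb| · |B ∩ a'Y_gb'| · ∏_cells e_q! ≤ ∏_rows bᵢ! · ∏_cols cⱼ!`,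
rows = blocks of `f`, columns = blocks of `g ∘ (a'⁻¹a)`, cells = blocks of the pair labelling. -/
theorem stub_hostedPairCount {n : ℕ} (A B : Finset (Equiv.Perm (Fin n))) (f g : Fin n → ℕ)
    (a b a' b' : Equiv.Perm (Fin n))
    (hAB : ∀ s ∈ A, ∀ s' ∈ A, ∀ t ∈ B, ∀ t' ∈ B, s * s'⁻¹ * (t * t'⁻¹) = 1 → s = s' ∧ t = t') :
    (A.filter (fun s => a⁻¹ * s * b⁻¹ ∈ youngSubgroup f)).card *
        (B.filter (fun t => a'⁻¹ * t * b'⁻¹ ∈ youngSubgroup g)).card *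
        ∏ q ∈ univ.image (fun p => (f p, g ((a'⁻¹ * a) p))),
          ((univ.filter (fun p => (f p, g ((a'⁻¹ * a) p)) = q)).card).factorial ≤
      (∏ i ∈ univ.image f, ((univ.filter (fun p => f p = i)).card).factorial) *
        ∏ j ∈ univ.image (fun p => g ((a'⁻¹ * a) p)),
          ((univ.filter (fun p => g ((a'⁻¹ * a) p) = j)).card).factorial := by
  have hK := hostedPairCount_card_filter_comp_eq (n := n) (fun p => (f p, g ((a'⁻¹ * a) p)))
  have hYF := hostedPairCount_card_filter_mem_le (n := n) f
  have hYG := hostedPairCount_card_filter_mem_le (n := n) (fun p => g ((a'⁻¹ * a) p))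
  have hmain := hostedPairCount_card_mul_le
    (A.filter (fun s => a⁻¹ * s * b⁻¹ ∈ youngSubgroup f))
    (B.filter (fun t => a'⁻¹ * t * b'⁻¹ ∈ youngSubgroup g))
    (univ.filter (fun σ : Equiv.Perm (Fin n) =>
      (fun p => (f p, g ((a'⁻¹ * a) p))) ∘ σ = fun p => (f p, g ((a'⁻¹ * a) p))))
    (univ.filter (fun σ : Equiv.Perm (Fin n) => σ ∈ youngSubgroup f))
    (univ.filter (fun σ : Equiv.Perm (Fin n) =>
      σ ∈ youngSubgroup (fun p => g ((a'⁻¹ * a) p))))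
    a b a' b' ?_ ?_ ?_
  · rw [hK] at hmain
    exact hmain.trans (Nat.mul_le_mul hYF hYG)
  · -- injectivity of `(s, t) ↦ s⁻¹ t` from the pairwise TPP
    intro s₁ hs₁ s₂ hs₂ t₁ ht₁ t₂ ht₂ he
    have h1 : s₂ * s₁⁻¹ * (t₁ * t₂⁻¹) = 1 :=
      calc s₂ * s₁⁻¹ * (t₁ * t₂⁻¹) = s₂ * (s₁⁻¹ * t₁) * t₂⁻¹ := by group
        _ = s₂ * (s₂⁻¹ * t₂) * t₂⁻¹ := by rw [he]
        _ = 1 := by group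
    have h2 := hAB s₂ (Finset.mem_filter.1 hs₂).1 s₁ (Finset.mem_filter.1 hs₁).1
      t₁ (Finset.mem_filter.1 ht₁).1 t₂ (Finset.mem_filter.1 ht₂).1 h1
    exact ⟨h2.1.symm, h2.2⟩
  · -- `K · (a⁻¹ A' b⁻¹) ⊆ Y_f`
    intro s hs k hk
    refine Finset.mem_filter.2 ⟨Finset.mem_univ _, ?_⟩
    have hk' := (Finset.mem_filter.1 hk).2
    refine (youngSubgroup f).mul_mem ?_ (Finset.mem_filter.1 hs).2
    rw [mem_youngSubgroup]
    intro p
    exact congrArg Prod.fst (congrFun hk' p)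
  · -- `K · y⁻¹ (a'⁻¹ B' b'⁻¹) y ⊆ Y_{g ∘ y}`
    intro t ht k hk
    refine Finset.mem_filter.2 ⟨Finset.mem_univ _, ?_⟩
    have hk' := (Finset.mem_filter.1 hk).2
    refine (youngSubgroup _).mul_mem ?_ (hostedPairCount_conj_mem (Finset.mem_filter.1 ht).2 _)
    rw [mem_youngSubgroup]
    intro p
    exact congrArg Prod.snd (congrFun hk' p)

end Summit.MatrixMultiplication.MatrixMultiplication.Theorems.GlobalBranch
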